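import Summits.QuantumFields.BalabanUV.T4Continuum.Support.ClusterRepKP
import Summits.QuantumFields.BalabanUV.T4Continuum.Support.InsertionLinearRate

/-!
# NE5 ∕ U3, route P2 — leaf L08 IN B13's LETTERS for the domain-geometry representation (`DecayExtract` from (2.27),
# `PinBudget` from the volume bound (2.30)) and the route's END over that representation with EVERY combinatorial leaf in
# printed letters (skeleton `t4/skeletons/NE5-t4-ne5-p2.md` §5 row O1′ R-KP ∕ §6: the END for NODE O's activity-route share)

Cell `pub-balaban`, unit `b2b-balaban-t4-ne5-p2-g17` (T⁴ fan-out NE5 ∕ node U3, PROVER seat P2 «polymer-activity Lipschitz route»).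
Summits-side new work under the LEAN PLACEMENT RULE (cell bookkeeping over landed leaves; NOT a Literature module).  HONEST FRAMING:
rung (B)+1 of the FINITE-VOLUME T⁴ continuum programme — NOT infinite volume, NOT a mass gap, NOT the Clay problem, NOT a proof of
NE5 (NOT PRINTED in [Balaban1987RG1]–[Balaban1989LargeFieldII]; they print ε-UNIFORM bounds, never η-RATES).  HONEST DEPENDENCY (cell
line, verbatim): continuum YM on T⁴ ⇐ BetaPertH ∧ nine spine estimates (0/9 proved); BetaPertH ⇐ (D1) ∧ (D4) ∧ CAP+tail; G-an2-4
gates asym, D1 and NE2/3/4.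

WHAT THIS FILE DOES.  For the cluster representation BUILT from the carriers' domain geometry (`ClusterRepOfDomains.DomainGeometry.
clusterRep`, p207086) the two printed ENGINES of leaf L08 are PROVED in [Balaban1988RG2Cluster]'s letters:
* `decayExtract_of_ineq227`: (2.27) p. 18 at every level, for the covering families of each domain's footprint
  (`B13FamilySum.Ineq227 (level k) cubes d (cubes X) (d X) c` — a hypothesis SHAPE with locator; printed `c = 5`), multiplied by the
  KP rate `σ ≥ 0`, IS `ClusterRep.DecayExtract (fun X => σ·(d X + c)) (fun Z => σ·d Z + σ·c)` — the `d`-weight of R-KP with `b = σc`;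
* `pinBudget_of_volBound`: the additive volume bound (2.30) p. 18 (`B13FamilySum.VolBound (level k) cubes d c₁`) and one unit of rate
  (`κ + 1 ≤ σ`, via `1 + x ≤ eˣ`) give `ClusterRep.PinBudget (fun Z => τ·#cubes Z) (fun X => σ·(d X + c)) (τ·c₁·e^{−σc}) κ` —
  print's (2.40)–(2.41) absorption *"the last exponential multiplied by exp(−½δLκd_{k+1}(X)) is bounded by 1"* (p. 21) in the
  anchored form (no volume factor |X|: the anchor is the pin `X` itself).
* `ne5_above_max_of_domainGeometry_linear`: the route's END (`InsertionLinearRate.ne5_above_max_of_model_reach_linear`) over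
  `R := G.clusterRep ρA ρB` with L03 := `ClusterRepKP.kpInflated_of_majorant` and L08 := the two lemmas above, so that EVERY
  combinatorial leaf is in printed letters: what is displayed is the (2.38)-SHAPED majorant (locator p. 20), (1.26)∕(2.27)∕(2.30)
  as SHAPES at every level, footprint locality (`reach`, ν), the rate room and the smallness, the term data (L04–L06), the levels
  (L09), MI-R (L01∕L02, readings), W1 `N.OperatorRate` (nodes U1a∕U1b), the insertion-data rates `BaseRate`∕`VecRate` and the age
  budget, the numeric census — and NOTHING else; conclusion literally `∃ C₅, T4OutputRate.NE5 EA EB W κ θ′ C₅` for θ′ > max θ r_fb.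
Nothing of the manuscripts under audit is asserted (cited for KIND∕locus only).  0 sorry; no new axioms.
-/

open scoped BigOperators

namespace Summit.QuantumFields.BalabanUV.T4Continuum.ClusterRepDecay

open Literature.MathematicalPhysics.QuantumFieldTheory.Balaban1983to89.T4OutputRate (Carriers Functional DecayBound NE5)
open Literature.MathematicalPhysics.QuantumFieldTheory.Balaban1983to89.T4ActivityLipschitz (ClusterRep)
open Literature.MathematicalPhysics.QuantumFieldTheory.Balaban1983to89.T4InputCauchyRateData (StepModel)
open Literature.MathematicalPhysics.QuantumFieldTheory.Balaban1983to89.B13FamilySum (Ineq126 VolBound Ineq227 coveringFamilies)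
open Summit.QuantumFields.BalabanUV.T4Continuum.ClusterRepOfDomains (DomainGeometry)
open Summit.QuantumFields.BalabanUV.T4Continuum.ClusterRepKP (kpInflated_of_majorant)
open Summit.QuantumFields.BalabanUV.T4Continuum.InsertionLinearClass (LinearInsertion)
open Summit.QuantumFields.BalabanUV.T4Continuum.InsertionLinearRate (ne5_above_max_of_model_reach_linear)
open Summit.QuantumFields.BalabanUV.T4Continuum.InsertionLinearRate.LinearPair (ReadsB BaseRate VecRate)
open Summit.QuantumFields.BalabanUV.T4Continuum.ActivityTermModel (TermFamily)
open Summit.QuantumFields.BalabanUV.T4Continuum.ActivityStepJunction (ReadsStep)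

variable {C : Carriers} [DecidableEq C.Dom] {Cube : Type*} [DecidableEq Cube] (G : DomainGeometry C Cube)

/-! ## §1 L08 in letters: (2.27) ⟹ `DecayExtract`, (2.30) + one unit of rate ⟹ `PinBudget` -/

/-- [folklore] **(2.27) at every level IS `DecayExtract`** for the domain-geometry representation, with the extracted weight
`δX X = σ·(d X + c)` and the KP weight `d Z ↦ σ·d Z + σ·c`. -/
theorem decayExtract_of_ineq227 (ρA ρB : (ℕ → ℝ) → C.BgB → C.Dom → ℂ) {σ c : ℝ} (hσ : 0 ≤ σ)
    (h227 : ∀ X : C.Dom, Ineq227 (G.level (C.scale X)) G.cubes C.d (G.cubes X) (C.d X) c) :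
    (G.clusterRep ρA ρB).DecayExtract (fun X => σ * (C.d X + c)) (fun Z => σ * C.d Z + σ * c) := by
  intro X K hK
  have h := h227 X K hK
  calc σ * (C.d X + c) ≤ σ * ∑ Y ∈ K, (C.d Y + c) := mul_le_mul_of_nonneg_left h hσ
    _ = ∑ Y ∈ K, (σ * C.d Y + σ * c) := by rw [Finset.mul_sum]; refine Finset.sum_congr rfl fun Y _ => by ring

/-- [folklore] One unit of rate absorbs the volume prefactor: `(1 + x)·e^{−σ(x + c)} ≤ e^{−σc}·e^{−κx}` for `x ≥ 0`, `κ + 1 ≤ σ`. -/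
theorem one_add_mul_exp_le {x σ κ c : ℝ} (hx : 0 ≤ x) (hσκ : κ + 1 ≤ σ) :
    (1 + x) * Real.exp (-(σ * (x + c))) ≤ Real.exp (-(σ * c)) * Real.exp (-(κ * x)) := by
  have h1 : 1 + x ≤ Real.exp x := by have := Real.add_one_le_exp x; linarith
  have h2 : Real.exp x * Real.exp (-(σ * (x + c))) = Real.exp (-(σ * c)) * Real.exp (-((σ - 1) * x)) := by
    rw [← Real.exp_add, ← Real.exp_add]; congr 1; ring
  calc (1 + x) * Real.exp (-(σ * (x + c))) ≤ Real.exp x * Real.exp (-(σ * (x + c))) :=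
        mul_le_mul_of_nonneg_right h1 (Real.exp_nonneg _)
    _ = Real.exp (-(σ * c)) * Real.exp (-((σ - 1) * x)) := h2
    _ ≤ Real.exp (-(σ * c)) * Real.exp (-(κ * x)) := by
        refine mul_le_mul_of_nonneg_left (Real.exp_le_exp.2 (neg_le_neg ?_)) (Real.exp_nonneg _)
        exact mul_le_mul_of_nonneg_right (by linarith) hx

/-- [folklore] **(2.30) + one unit of rate IS `PinBudget`** for the domain-geometry representation (pin = the domain itself):
`τ·#cubes X·e^{−σ(d X + c)} ≤ (τ·c₁·e^{−σc})·e^{−κ·d X}` whenever `κ + 1 ≤ σ` — the anchored (2.40)–(2.41) absorption. -/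
theorem pinBudget_of_volBound (ρA ρB : (ℕ → ℝ) → C.BgB → C.Dom → ℂ) {τ σ κ c c₁ : ℝ} (hτ : 0 ≤ τ) (hc₁ : 0 ≤ c₁)
    (hσκ : κ + 1 ≤ σ) (hvol : ∀ k, VolBound (G.level k) G.cubes C.d c₁) :
    (G.clusterRep ρA ρB).PinBudget (fun Z => τ * ((G.cubes Z).card : ℝ)) (fun X => σ * (C.d X + c))
      (τ * c₁ * Real.exp (-(σ * c))) κ := by
  intro X
  change τ * ((G.cubes X).card : ℝ) * Real.exp (-(σ * (C.d X + c))) ≤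
    τ * c₁ * Real.exp (-(σ * c)) * Real.exp (-(κ * C.d X))
  have hX : ((G.cubes X).card : ℝ) ≤ c₁ * (1 + C.d X) := hvol (C.scale X) X (G.self_mem_level X)
  have hd : 0 ≤ C.d X := C.d_nonneg X
  calc τ * ((G.cubes X).card : ℝ) * Real.exp (-(σ * (C.d X + c)))
      ≤ τ * (c₁ * (1 + C.d X)) * Real.exp (-(σ * (C.d X + c))) :=
        mul_le_mul_of_nonneg_right (mul_le_mul_of_nonneg_left hX hτ) (Real.exp_nonneg _)
    _ = τ * c₁ * ((1 + C.d X) * Real.exp (-(σ * (C.d X + c)))) := by ring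
    _ ≤ τ * c₁ * (Real.exp (-(σ * c)) * Real.exp (-(κ * C.d X))) :=
        mul_le_mul_of_nonneg_left (one_add_mul_exp_le hd hσκ) (mul_nonneg hτ hc₁)
    _ = τ * c₁ * Real.exp (-(σ * c)) * Real.exp (-(κ * C.d X)) := by ring

/-! ## §2 The route's END over the domain-geometry representation: every combinatorial leaf in printed letters -/

section End

variable {Op Hist : Type*} [NormedAddCommGroup Op] [NormedSpace ℂ Op] [NormedAddCommGroup Hist] [NormedSpace ℂ Hist]
variable {ι κι S Ω Ω₀ 𝒴 𝒞 : Type*} [Fintype ι] [Fintype κι] [MeasurableSpace Ω] [MeasurableSpace Ω₀] {J : Type*}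
  [DecidableEq ι] [DecidableEq κι] [DecidableEq 𝒞]

/-- [folklore] **THE ACTIVITY ROUTE's END OVER THE DOMAIN-GEOMETRY REPRESENTATION, LETTERED.**  For `R := G.clusterRep ρA ρB`, a term
model over `R` reading the step model `N`, linear insertions for both runs: L03 := `kpInflated_of_majorant` (from the (2.38)-shaped
majorant `m ≤ A_m·e^{−R_m·d}` on every level + (1.26) + (2.30) + locality + `κ₀ + σ + τc₁ ≤ R_m` + `(1 + s)·A_m·e^{σc+τc₁}·K₀·ν ≤ τ`),
L08 := `decayExtract_of_ineq227` + `pinBudget_of_volBound` (from (2.27) + (2.30) + `κ + 1 ≤ σ`), W3 ∧ structure ∧ W4 from the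
linear class (`AgeBudget`, `BaseRate`, `VecRate`), W1 `N.OperatorRate`, the term data, the levels, MI-R, the numeric census.
Output amplitude `A = τ·c₁·e^{−σc}`.  Conclusion literally `∃ C₅, NE5 EA EB W κ θ′ C₅`. -/
theorem ne5_above_max_of_domainGeometry_linear (ρA ρB : (ℕ → ℝ) → C.BgB → C.Dom → ℂ)
    (𝔉 : TermFamily (G.clusterRep ρA ρB) Op Hist ι κι S Ω Ω₀ 𝒴 𝒞 J) {N : StepModel C Op Hist} (hN : ReadsStep 𝔉.model N)
    {EA : Functional C C.BgA} {EB : Functional C C.BgB} {W : Set (ℕ → ℝ)}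
    {LA LB : LinearInsertion C Hist} (hLA : LA.Reads N W) (hLB : ReadsB LB N W) (hdom : ∀ k, LA.dom k = LB.dom k)
    {m : (ℕ → ℝ) → C.BgB → C.Dom → ℝ} (reach : C.Dom → Finset Cube)
    {A_m R_m κ₀ K₀ c₁ τ σ c ν s A₀ E₀ E₁ κ θ δ δb δv cg ω Λop Λhist ρ₀ ρ₀' : ℝ}
    -- L03 in letters (R-KP)
    (hloc : ∀ Z Z', G.touch (G.cubes Z') (G.cubes Z) → ∃ q ∈ reach Z, q ∈ G.cubes Z')
    (hreach : ∀ Z, ((reach Z).card : ℝ) ≤ ν * (G.cubes Z).card)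
    (hA_m : 0 ≤ A_m) (hK₀ : 0 ≤ K₀) (hτ : 0 ≤ τ) (hσ : 0 ≤ σ) (hc : 0 ≤ c) (hc₁ : 0 ≤ c₁) (hs0 : 0 ≤ s)
    (hm0 : ∀ (g : ℕ → ℝ) (U : C.BgB) (Z : C.Dom), 0 ≤ m g U Z)
    (hm : ∀ g ∈ W, ∀ (U : C.BgB) (k : ℕ), ∀ Z ∈ G.level k, m g U Z ≤ A_m * Real.exp (-(R_m * C.d Z)))
    (h126 : ∀ k, Ineq126 (G.level k) G.cubes C.d κ₀ K₀) (hvol : ∀ k, VolBound (G.level k) G.cubes C.d c₁)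
    (h227 : ∀ X : C.Dom, Ineq227 (G.level (C.scale X)) G.cubes C.d (G.cubes X) (C.d X) c)
    (hrate : κ₀ + σ + τ * c₁ ≤ R_m) (hsmall : (1 + s) * A_m * Real.exp (σ * c + τ * c₁) * K₀ * ν ≤ τ) (hσκ : κ + 1 ≤ σ)
    -- the term model (L04–L06), the per-term majorant domination, MI-R, the levels (L09)
    (hwf : 𝔉.WellFormed W)
    (hsum : ∀ g ∈ W, ∀ (U : C.BgB) (X : C.Dom), ∀ γ ∈ (G.clusterRep ρA ρB).vol X,
      ∑ i ∈ 𝔉.terms g U X γ, 𝔉.G Λop Λhist ρ₀ g U X γ i ≤ m g U γ)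
    (hρ01 : ρ₀ ≤ 1)
    (hrep : (G.clusterRep ρA ρB).Represents EA EB) (hreal : 𝔉.model.Realizes EA EB W) (hbase : 𝔉.model.InBase EB W)
    (hdA : DecayBound EA W A₀ κ) (hdB : DecayBound EB W E₀ κ)
    -- W1 (nodes U1a ∕ U1b), the insertion-data rates and the age budget (NE2-TYPE ∕ one-run), numerics
    (hop : N.OperatorRate W δ θ)
    (hbr : BaseRate LA LB N W δb θ) (hvr : VecRate LA LB N W κ δv θ) (hbudget : LA.AgeBudget N W κ cg ω)
    (hE₀ : 0 ≤ E₀) (hδb : 0 ≤ δb) (hδv : 0 ≤ δv)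
    (hE₁ : 0 < E₁) (hΛop : 0 < Λop) (hΛhist : 0 < Λhist) (hρ : max (Λhist / Λop) 1 * ρ₀' ≤ ρ₀)
    (hs : Λhist * ρ₀' < s) (hδ : 0 ≤ δ) (hθ : 0 ≤ θ) (hθ1 : θ < 1)
    (hcg : 0 ≤ cg) (hω : 0 < ω) (hω1 : ω < 1) (hreachH : cg * (A₀ + E₀) / (1 - ω) < ρ₀')
    {θ' : ℝ} (hθ' : max θ (ω + (τ * c₁ * Real.exp (-(σ * c))) * Λhist / (s - Λhist * ρ₀') * cg) < θ') :
    ∃ C₅, NE5 EA EB W κ θ' C₅ := by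
  have hb : 0 ≤ σ * c := mul_nonneg hσ hc
  have hsmall' : (1 + s) * A_m * Real.exp (σ * c + τ * c₁) * K₀ * ν ≤ τ := hsmall
  have hKP := kpInflated_of_majorant G ρA ρB reach C.d (W := W) (m := m) hloc hreach C.d_nonneg hA_m hK₀ hτ hσ hb hs0 hm0 hm
    h126 hvol hrate hsmall'
  have hdec := decayExtract_of_ineq227 G ρA ρB hσ h227
  have hpin := pinBudget_of_volBound G ρA ρB (c := c) hτ hc₁ hσκ hvol
  have hA : 0 ≤ τ * c₁ * Real.exp (-(σ * c)) := mul_nonneg (mul_nonneg hτ hc₁) (Real.exp_nonneg _)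
  exact ne5_above_max_of_model_reach_linear 𝔉 hN hLA hLB hdom hwf hsum hρ01 hrep hreal hbase hKP hdec hpin hdA hdB hop hbr
    hvr hbudget hE₀ hδb hδv hE₁ hA hΛop hΛhist hρ hs hδ hθ hθ1 hcg hω hω1 hreachH hθ'

end End

end Summit.QuantumFields.BalabanUV.T4Continuum.ClusterRepDecay
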